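import Summits.ResolutionOfSingularities.ResolutionOfSingularities.Theorems.HilbertSamuelEliminationSigmaMaxModificationsCorridor3WLadderIsoTailsArcTranslatedGen
import Mathlib.RingTheory.Ideal.Colon
import Mathlib.RingTheory.Ideal.Maps
import Mathlib.RingTheory.Ideal.Quotient.Operations
import HarnessLib

/-!
# [OURS · L1 W4.2 · D14 ROUTE G v2 «ARC LIMIT» · G2b] SHEAR CONJUGATION: the composite of `n` translated chart steps is the pure
# scaling `ArcLimit.scale d K n` in sheared coordinates — for series AND for ideals of `K⟦t, y_1, …, y_d⟧`
# (crux `SigmaMaxModifications` stmt-ResolutionOfSingularities-18506 / conjunct stmt-…-19249; line `w_ladder` v8.3; kernel K1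
# `IsoFreeRationalTailsImpossible` in EVERY embedding dimension; `--supports stmt-ResolutionOfSingularities-19249`, helper)

OURS (cell `res-hironaka`, slot ★L-G4 W4.2; hand res-type-071, object G2b of res-L1-w42-lead-1's memo `ROUTE-G-ARCLIMIT.md` sha16
`96c77a196e17bc23` §1 KEY IDENTITY / §4 «G2b SHEAR CONJUGATION FOR IDEALS: composite of n translated charts = shear⁻¹ ∘ scale_n ∘ shear_n»,
GO res-L1-w42-plan-1 RULING v3.14-34 (HL)). Def-free; pure substitution algebra over any commutative ring `K` in `S = K⟦X_0, …, X_d⟧`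
(`t = X 0`), over file 1 of G0-L (`SeriesGen.transChartSubst/shearSubst/subst_chart_subst_shear`) and lead-1's `ArcLimit.scale` (p535603).

Notation: translations `c : ℕ → (Fin (d+1) → K)` of a free-rational tail (`c k` = the `κ`-point of step `k`, `c 0` unread); the STAGE-`n`
SHEAR `θ_n := shearSubst (k ↦ c (n + k))` (`y_i ↦ y_i + Σ_{k ≥ 1} c_{n+k,i} t^k` — reading a stage-`n` series in the sheared coordinates
`ỹ⁽ⁿ⁾ = y − Σ_{k>n} c_k t^{k−n}`); the composite of the translated steps `T_n = substHom (c n) ∘ ⋯ ∘ substHom (c 1)` is taken ABSTRACTLY as any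
sequence of ring endomorphisms `T` with `T 0 = id`, `T (n+1) = subst (transChartSubst (c (n+1))) ∘ T n` (the frames of a tower supply
`T_n ∘ ψ_0 = ψ_n ∘ ι_{0→n}` by `FormalFrameGen.stepFrame_algebraMap_algebraMap`).

* `subst_scale_zero`, `subst_scale_subst_scale` — `scale_0 = id`, `scale_m ∘ scale_n = scale_{n+m}`;
* **`subst_scale_subst_shear_eq`** — `scale_n (θ_0 g) = θ_n (T_n g)` for every series `g` (induction on `n` over the one-step identity
  `subst_chart_subst_shear`);
* **`subst_scale_mem_map_shear`** — IDEAL FORM consumed by G2c: if `J.map (T n) ≤ Jn n` for all `n` (the frames carry `ker σ_0` into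
  `ker σ_n`: G2a (⊇) + commutation), then `g ∈ J.map θ_0 ⇒ scale_n g ∈ (Jn n).map θ_n` — the hypothesis
  `∀ n g, g ∈ J♯ → subst (scale n) g ∈ Jn♯ n` of the limit inequality with `J♯ := J.map θ_0`, `Jn♯ n := (Jn n).map θ_n`;
* `subst_shear_X_zero`, **`colon_X_zero_map_shear`** — shearing is an automorphism fixing `t`, so `t`-saturation is transported:
  `(I.colon {t} = I) → ((I.map θ).colon {t} = I.map θ)` (the other G2c hypothesis, from G2a (sat));
  `map_shear_map_shear_neg` / `comap_shear_eq_map_shear_neg` (the inverse shear), `quotEquivMapShear`-free statement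
  `exists_ringEquiv_quotient_map_shear : Nonempty ((S ⧸ I) ≃+* (S ⧸ I.map θ))` (so Hilbert–Samuel functions agree, by the tree's
  `hilbertSamuelFun_eq_of_ringEquiv`, at the consumer).

NOT a statement of H. Hironaka's manuscript [Hironaka2017] nor of [CossartJannsenSaito2020] / [CossartPiltant2009]; AI-written, weaker than
expert review. [cite: CossartPiltant2009, ch. 3 I.9 (formal arcs)]
-/

set_option linter.dupNamespace false -- mandated namespace of this single-conjunct summit
open MvPowerSeries

noncomputable section

namespace Summit.ResolutionOfSingularities.ResolutionOfSingularities.Cruxes.SigmaMaxModifications.IdeasL1C5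

universe u

namespace SeriesGen

variable {d : ℕ} {K : Type u} [CommRing K]

/-! ### §1. The scalings compose -/

/-- `scale_0` is the identity substitution. [folklore] -/
theorem scale_zero_eq_X : ArcLimit.scale d K 0 = MvPowerSeries.X := by
  funext i
  by_cases hi : i = 0
  · subst hi; exact ArcLimit.scale_zero_apply 0
  · rw [ArcLimit.scale_apply_of_ne_zero 0 hi, pow_zero, one_mul]

/-- `subst scale_0 = id`. [folklore] -/
theorem subst_scale_zero (g : MvPowerSeries (Fin (d + 1)) K) : subst (ArcLimit.scale d K 0) g = g := by
  rw [scale_zero_eq_X, subst_self]; rfl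

/-- `scale_m (scale_n g) = scale_{n+m} g`. [folklore] -/
theorem subst_scale_subst_scale (m n : ℕ) (g : MvPowerSeries (Fin (d + 1)) K) :
    subst (ArcLimit.scale d K m) (subst (ArcLimit.scale d K n) g) = subst (ArcLimit.scale d K (n + m)) g := by
  rw [subst_comp_subst_apply (ArcLimit.hasSubst_scale n) (ArcLimit.hasSubst_scale m)]
  congr 1
  funext i
  by_cases hi : i = 0
  · subst hi
    rw [ArcLimit.scale_zero_apply, subst_X (ArcLimit.hasSubst_scale m), ArcLimit.scale_zero_apply, ArcLimit.scale_zero_apply]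
  · rw [ArcLimit.scale_apply_of_ne_zero _ hi, ← substAlgHom_apply (ArcLimit.hasSubst_scale m), map_mul, map_pow,
      substAlgHom_apply, substAlgHom_apply, subst_X (ArcLimit.hasSubst_scale m), subst_X (ArcLimit.hasSubst_scale m),
      ArcLimit.scale_zero_apply, ArcLimit.scale_apply_of_ne_zero _ hi, ← mul_assoc, ← pow_add,
      ArcLimit.scale_apply_of_ne_zero _ hi]

/-! ### §2. The composite of `n` translated steps is `scale_n` in sheared coordinates -/

section Composite

variable (c : ℕ → Fin (d + 1) → K)
  (T : ℕ → (MvPowerSeries (Fin (d + 1)) K →+* MvPowerSeries (Fin (d + 1)) K))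
  (hT0 : ∀ g, T 0 g = g) (hT : ∀ n g, T (n + 1) g = subst (transChartSubst (c (n + 1))) (T n g))
include hT0 hT

/-- **SHEAR CONJUGATION (series).** `scale_n (θ_0 g) = θ_n (T_n g)`: in the sheared coordinates at both ends the composite of the
`n` translated chart steps `y ↦ t y + c_k t` (`k = 1, …, n`) is the pure scaling `y ↦ tⁿ y`. [folklore] -/
theorem subst_scale_subst_shear_eq (n : ℕ) (g : MvPowerSeries (Fin (d + 1)) K) :
    subst (ArcLimit.scale d K n) (subst (shearSubst c) g) = subst (shearSubst fun k => c (n + k)) (T n g) := by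
  induction n with
  | zero =>
    simp only [Nat.zero_add]
    rw [subst_scale_zero, hT0]
  | succ n ih =>
    rw [← subst_scale_subst_scale 1 n, ih, subst_chart_subst_shear c n (T n g), ← hT n]

/-- The same as an identity of ring endomorphisms of `K⟦t, y⟧`. [folklore] -/
theorem substAlgHom_scale_comp_shear_eq (n : ℕ) :
    (substAlgHom (ArcLimit.hasSubst_scale (K := K) n)).toRingHom.comp (substAlgHom (hasSubst_shearSubst c)).toRingHom =
      (substAlgHom (hasSubst_shearSubst fun k => c (n + k))).toRingHom.comp (T n) := by
  refine RingHom.ext fun g => ?_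
  simp only [RingHom.coe_comp, Function.comp_apply, AlgHom.toRingHom_eq_coe, RingHom.coe_coe, substAlgHom_apply]
  exact subst_scale_subst_shear_eq c T hT0 hT n g

/-- **SHEAR CONJUGATION (ideals) — the inclusion hypothesis of the limit inequality G2c.** If the composite steps carry `J` into
`Jn n` (`J.map (T n) ≤ Jn n`; for a tower: `ker σ_0 ↦ ker σ_n` by G2a (⊇) and the frame commutation), then with `J♯ := J.map θ_0` and
`Jn♯ n := (Jn n).map θ_n`: `g ∈ J♯ ⇒ scale_n g ∈ Jn♯ n`. [folklore] -/
theorem subst_scale_mem_map_shear (J : Ideal (MvPowerSeries (Fin (d + 1)) K)) (Jn : ℕ → Ideal (MvPowerSeries (Fin (d + 1)) K))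
    (hJ : ∀ n, J.map (T n) ≤ Jn n) (n : ℕ) {g : MvPowerSeries (Fin (d + 1)) K}
    (hg : g ∈ J.map (substAlgHom (hasSubst_shearSubst c)).toRingHom) :
    subst (ArcLimit.scale d K n) g ∈ (Jn n).map (substAlgHom (hasSubst_shearSubst fun k => c (n + k))).toRingHom := by
  have h1 : subst (ArcLimit.scale d K n) g = (substAlgHom (ArcLimit.hasSubst_scale (K := K) n)).toRingHom g := by
    rw [AlgHom.toRingHom_eq_coe, RingHom.coe_coe, substAlgHom_apply]
  rw [h1]
  have h2 := Ideal.mem_map_of_mem (substAlgHom (ArcLimit.hasSubst_scale (K := K) n)).toRingHom hg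
  rw [Ideal.map_map, substAlgHom_scale_comp_shear_eq c T hT0 hT n, ← Ideal.map_map] at h2
  exact Ideal.map_mono (hJ n) h2

end Composite

/-! ### §3. Shearing is an automorphism fixing `t`: saturation and quotients are transported -/

/-- `θ(t) = t`. [folklore] -/
theorem subst_shear_X_zero (b : ℕ → Fin (d + 1) → K) :
    subst (shearSubst b) (X 0 : MvPowerSeries (Fin (d + 1)) K) = X 0 := by
  rw [subst_X (hasSubst_shearSubst b), shearSubst_apply_zero]

/-- The inverse shear undoes the shear, as ring endomorphisms. [folklore] -/
theorem substAlgHom_shear_neg_comp (b : ℕ → Fin (d + 1) → K) :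
    (substAlgHom (hasSubst_shearSubst (K := K) fun k i => -b k i)).toRingHom.comp
      (substAlgHom (hasSubst_shearSubst b)).toRingHom = RingHom.id _ := by
  refine RingHom.ext fun g => ?_
  simp only [RingHom.coe_comp, Function.comp_apply, AlgHom.toRingHom_eq_coe, RingHom.coe_coe, substAlgHom_apply, RingHom.id_apply]
  exact subst_shear_neg_subst_shear b g

/-- The shear undoes the inverse shear, as ring endomorphisms. [folklore] -/
theorem substAlgHom_shear_comp_neg (b : ℕ → Fin (d + 1) → K) :
    (substAlgHom (hasSubst_shearSubst b)).toRingHom.comp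
      (substAlgHom (hasSubst_shearSubst (K := K) fun k i => -b k i)).toRingHom = RingHom.id _ := by
  refine RingHom.ext fun g => ?_
  simp only [RingHom.coe_comp, Function.comp_apply, AlgHom.toRingHom_eq_coe, RingHom.coe_coe, substAlgHom_apply, RingHom.id_apply]
  exact subst_shear_subst_shear_neg b g

/-- **The shear as a ring AUTOMORPHISM** of `K⟦t, y⟧` (existence form, def-free): some `e : S ≃+* S` acts as `subst (shearSubst b)`,
its inverse as the opposite shear. [folklore] -/
theorem exists_ringEquiv_shear (b : ℕ → Fin (d + 1) → K) :
    ∃ e : MvPowerSeries (Fin (d + 1)) K ≃+* MvPowerSeries (Fin (d + 1)) K,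
      (∀ g, e g = subst (shearSubst b) g) ∧ (∀ g, e.symm g = subst (shearSubst fun k i => -b k i) g) :=
  ⟨RingEquiv.ofRingHom (substAlgHom (hasSubst_shearSubst b)).toRingHom
      (substAlgHom (hasSubst_shearSubst (K := K) fun k i => -b k i)).toRingHom
      (substAlgHom_shear_comp_neg b) (substAlgHom_shear_neg_comp b),
    fun g => by simp [RingEquiv.ofRingHom_apply, substAlgHom_apply],
    fun g => by simp [substAlgHom_apply]⟩

/-- Membership in a sheared ideal: `g ∈ I.map θ ↔ θ⁻¹ g ∈ I`. [folklore] -/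
theorem mem_map_shear_iff (b : ℕ → Fin (d + 1) → K) (I : Ideal (MvPowerSeries (Fin (d + 1)) K))
    (g : MvPowerSeries (Fin (d + 1)) K) :
    g ∈ I.map (substAlgHom (hasSubst_shearSubst b)).toRingHom ↔ subst (shearSubst fun k i => -b k i) g ∈ I := by
  obtain ⟨e, he, he'⟩ := exists_ringEquiv_shear (K := K) b
  have hmap : I.map (substAlgHom (hasSubst_shearSubst b)).toRingHom = I.map (e : _ →+* _) := by
    congr 1
    exact RingHom.ext fun g => by rw [AlgHom.toRingHom_eq_coe, RingHom.coe_coe, substAlgHom_apply, RingHom.coe_coe, he]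
  rw [hmap, ← he' g]
  exact (Ideal.symm_apply_mem_of_equiv_iff (f := e)).symm

/-- **`t`-SATURATION IS TRANSPORTED BY THE SHEAR** (the second hypothesis of G2c, from G2a (sat)): if `(I : t) = I` then
`(I.map θ : t) = I.map θ`. [folklore] -/
theorem colon_X_zero_map_shear (b : ℕ → Fin (d + 1) → K) {I : Ideal (MvPowerSeries (Fin (d + 1)) K)}
    (hI : I.colon {(X 0 : MvPowerSeries (Fin (d + 1)) K)} = I) :
    (I.map (substAlgHom (hasSubst_shearSubst b)).toRingHom).colon {(X 0 : MvPowerSeries (Fin (d + 1)) K)} =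
      I.map (substAlgHom (hasSubst_shearSubst b)).toRingHom := by
  ext g
  rw [Submodule.mem_colon_singleton, smul_eq_mul, mem_map_shear_iff, mem_map_shear_iff,
    ← substAlgHom_apply (hasSubst_shearSubst _), map_mul, substAlgHom_apply, substAlgHom_apply, subst_shear_X_zero]
  conv_rhs => rw [← hI]
  rw [Submodule.mem_colon_singleton, smul_eq_mul]

/-- **QUOTIENTS ARE TRANSPORTED BY THE SHEAR**: `S ⧸ I ≃ S ⧸ I.map θ` (so the Hilbert–Samuel functions of the two quotients agree — tree
`hilbertSamuelFun_eq_of_ringEquiv` — the third hypothesis of G2c is insensitive to shearing). [folklore] -/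
theorem nonempty_ringEquiv_quotient_map_shear (b : ℕ → Fin (d + 1) → K) (I : Ideal (MvPowerSeries (Fin (d + 1)) K)) :
    Nonempty ((MvPowerSeries (Fin (d + 1)) K ⧸ I) ≃+*
      (MvPowerSeries (Fin (d + 1)) K ⧸ I.map (substAlgHom (hasSubst_shearSubst b)).toRingHom)) := by
  obtain ⟨e, he, -⟩ := exists_ringEquiv_shear (K := K) b
  have hmap : I.map (substAlgHom (hasSubst_shearSubst b)).toRingHom = I.map (e : _ →+* _) := by
    congr 1
    exact RingHom.ext fun g => by rw [AlgHom.toRingHom_eq_coe, RingHom.coe_coe, substAlgHom_apply, RingHom.coe_coe, he]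
  exact ⟨Ideal.quotientEquiv I _ e hmap⟩

end SeriesGen

end Summit.ResolutionOfSingularities.ResolutionOfSingularities.Cruxes.SigmaMaxModifications.IdeasL1C5

end
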